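import Summits.MatrixMultiplication.MatrixMultiplication.Theorems.AbelianSTPPCensusTAStatBDefs

/-!
# T_A certificate, second range `5001 … 5666` (static t*-indexed linear checker): kernel evaluation, shape checks, volumes `3101 … 3472`

Cell mm-stpp (rung F-M1), threshold T_A = `τ = 2.371`; checker in `AbelianSTPPCensusTAStatBDefs.lean`, table in `AbelianSTPPCensusTAStatBData.lean`.
`decide` with kernel reduction (standard axioms; no `native_decide`), `Elab.async false`, one theorem per chunk of volumes; consumed by
`TAStatB.checkV_sound` / `TAStatB.domV_sound` in the leaf `AbelianSTPPCensusLeafTA5666Closed.lean`.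
WHAT THIS IS NOT: arithmetic on shape lists only; no statement about STPP families or `ω`.
-/

set_option linter.dupNamespace false
set_option autoImplicit false
set_option Elab.async false

namespace Summit.MatrixMultiplication.MatrixMultiplication.Theorems.TAStatB

set_option maxHeartbeats 0 in
/-- Check chunk: every sorted candidate shape of the volumes `3101 … 3192` passes `checkShape` (45157 (shape, bucket) checks). [original] -/
theorem ck3101 : TAStatB.checkV 92 3101 = true := by decide +kernel

set_option maxHeartbeats 0 in
/-- Check chunk: every sorted candidate shape of the volumes `3193 … 3288` passes `checkShape` (45842 (shape, bucket) checks). [original] -/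
theorem ck3193 : TAStatB.checkV 96 3193 = true := by decide +kernel

set_option maxHeartbeats 0 in
/-- Check chunk: every sorted candidate shape of the volumes `3289 … 3380` passes `checkShape` (45133 (shape, bucket) checks). [original] -/
theorem ck3289 : TAStatB.checkV 92 3289 = true := by decide +kernel

set_option maxHeartbeats 0 in
/-- Check chunk: every sorted candidate shape of the volumes `3381 … 3472` passes `checkShape` (45768 (shape, bucket) checks). [original] -/
theorem ck3381 : TAStatB.checkV 92 3381 = true := by decide +kernel

end Summit.MatrixMultiplication.MatrixMultiplication.Theorems.TAStatB
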